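import Summits.Ventures.LatticeQCDFlow.Scaling.FlowLadderEquivariantCeiling
import Summits.Ventures.LatticeQCDFlow.Scaling.FlowHubSchemeFloor
import Summits.Ventures.LatticeQCDFlow.Scaling.SectorCountMixingFloor

/-!
HONEST FRAMING: exact (Metropolis-corrected) sampling algorithms for lattice gauge theory; figures
of merit are autocorrelation/cost numbers at stated couplings and volumes; no continuum-physics
claim.

# FlowLadderEquivariantMixingFloor — THE LINEAR LAW WITHOUT REVERSIBILITY FOR MAP-ASSISTED SCHEMES: IF AN EXCHANGE MOVE
# `Q` (ANY SCHEDULE OF MAP SWAPS, METROPOLIS OR NOT, LIFTED OR NOT) PRESERVES THE IMAGE COUNT `Σ_k 1[x_k ∈ A_k]` OF A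
# FAMILY OF SETS CARRIED BY LEVEL BIJECTIONS, AND THE COLD UPDATES ARE FROZEN ON THEIR SETS, THEN EVERY
# `P = sQ + (1−s)·prodKernel w M` HAS `d(t) ≤ 1/4 ⇒ Σ_kμ_k(A_k) < 8t(1−s)w_0` — `Scaling/SectorCountMixingFloor`'S LAW IN
# LEVEL COORDINATES (lean-2 GEN-21, ours)

Venture-side (OURS).  Cell `lqcd-flow` (pub-lqcd), unit `pub-lqcd-lean-2-g21`, 2026-08-26.  Chapter I, fifteenth file.
`Scaling/FlowLadderEquivariantCeiling` / `Scaling/FlowHubEquivariantCeiling` bound the SPECTRAL GAP of the REVERSIBLE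
map-assisted samplers.  The reversibility-free linear law of `Scaling/SectorCountMixingFloor` (H4: a statistic that
moves by at most one unit per step with expected increase `≤ p` cannot travel `m̄/2` in fewer than `m̄/(8p)` steps)
transfers to map-assisted schemes by the same change of coordinates once the worst-case total-variation distance is
known to be invariant under relabelling (§1).  The statistic is the IMAGE COUNT `Σ_k 1[x_k ∈ A_k]` of a family
`A_k = L_k⁻¹(B)`; a map swap through `φ_j = L_{j+1}⁻¹∘L_j` — accepted by any rule whatsoever — preserves it.

## What is proved

* §1 (generic) `stepLaw_relabel`, `lawAt_relabel`, `single_relabel`, `tvDist_relabel`, **`worstTvDist_relabel`**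
  (`d_{P∘(e×e), π∘e}(t) = d_{P,π}(t)` for a bijection `e`).
* §2 **`imageCount_mixing_floor`** — level bijections `L`, one set `B` missing a point, images `A_k = L_k⁻¹B` with
  `Σ_kμ_k(A_k) ≥ 16`; `Q` ANY row-stochastic matrix preserving `Σ_k1[x_k ∈ A_k]`; cold `M_k` frozen pointwise on `A_k`;
  `P = sQ + (1−s)·prodKernel w M`: `d(t) ≤ 1/4 ⇒ Σ_kμ_k(A_k) < 8t(1−s)w_0`.
  **`equivariantCount_mixing_floor`** — the same for a `φ`-equivariant family `A_{j+1} = φ_j(A_j)`.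

Reading (no numerics implied): lifting, sweeping or de-randomising the map swaps cannot beat order `K/((1−s)w_0)` steps
either, as long as the maps carry metastable sets onto metastable sets.  NOT CLAIMED: anything measured.  Literature
grade (cell rule): OWN COROLLARY of H4; nothing cited as a fact; no new bib keys.
-/

noncomputable section

open Finset Function
open Literature.Probability.MarkovChains

namespace Summit.Ventures.LatticeQCDFlow.Scaling

/-! ## §1 Worst-case total variation is invariant under relabelling -/

section Generic

variable {X : Type*} [Fintype X]

omit [Fintype X] in
/-- One step of the relabelled chain from the relabelled law is the relabelled step. [ours] -/
theorem stepLaw_relabel [Fintype X] (e : X ≃ X) (P : X → X → ℝ) (m : X → ℝ) :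
    stepLaw (fun a b => P (e a) (e b)) (fun a => m (e a)) = fun a => stepLaw P m (e a) := by
  funext a
  unfold stepLaw
  exact Equiv.sum_comp e (fun x => m x * P x (e a))

/-- `t` steps likewise. [ours] -/
theorem lawAt_relabel (e : X ≃ X) (P : X → X → ℝ) (m : X → ℝ) (t : ℕ) :
    lawAt (fun a b => P (e a) (e b)) (fun a => m (e a)) t = fun a => lawAt P m t (e a) := by
  induction t with
  | zero => rfl
  | succ n ih => rw [lawAt_succ, lawAt_succ, ih, stepLaw_relabel]

omit [Fintype X] in
/-- The point mass relabels: `δ_{e x}∘e = δ_x`. [ours] -/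
theorem single_relabel [DecidableEq X] (e : X ≃ X) (x : X) :
    (fun a => (Pi.single (e x) (1 : ℝ) : X → ℝ) (e a)) = Pi.single x 1 := by
  funext a
  by_cases h : a = x
  · subst h; simp
  · rw [Pi.single_eq_of_ne h, Pi.single_eq_of_ne (fun h' => h (e.injective h'))]

/-- Total variation is invariant under relabelling. [ours] -/
theorem tvDist_relabel (e : X ≃ X) (m n : X → ℝ) :
    tvDist (fun a => m (e a)) (fun a => n (e a)) = tvDist m n := by
  unfold tvDist
  rw [Equiv.sum_comp e (fun x => |m x - n x|)]

/-- **`d(t)` is invariant under relabelling:** `d_{P∘(e×e), π∘e}(t) = d_{P,π}(t)`. [ours] -/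
theorem worstTvDist_relabel [DecidableEq X] (e : X ≃ X) (P : X → X → ℝ) (π : X → ℝ) (t : ℕ) :
    worstTvDist (fun a b => P (e a) (e b)) (fun a => π (e a)) t = worstTvDist P π t := by
  unfold worstTvDist
  rw [← Equiv.iSup_comp (g := fun y => tvDist (lawAt P (Pi.single y 1) t) π) e]
  congr 1
  funext x
  rw [← single_relabel e x, lawAt_relabel e P (Pi.single (e x) 1) t, tvDist_relabel]

end Generic

/-! ## §2 The linear law for image counts -/

variable {S : Type*} [Fintype S] [DecidableEq S] {K : ℕ} {μ : Fin (K + 1) → S → ℝ}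
  {M : Fin (K + 1) → S → S → ℝ} {w : Fin (K + 1) → ℝ}

/-- **THE LINEAR LAW FOR AN IMAGE COUNT, REVERSIBLE OR NOT:** level bijections `L`, a set `B` missing a point `u₀`,
images `A_k = L_k⁻¹(B)` with `Σ_kμ_k(A_k) ≥ 16`; `Q` ANY row-stochastic matrix preserving `Σ_k1[x_k ∈ A_k]`; cold
updates frozen pointwise on their images (`M_k(u,v) ≠ 0 ⇒ (u ∈ A_k ↔ v ∈ A_k)`, `k ≠ 0`); `w` a probability vector,
`0 ≤ s ≤ 1`, `P = sQ + (1−s)·prodKernel w M`.  Then `d(t) ≤ 1/4 ⇒ Σ_kμ_k(A_k) < 8·t·(1−s)·w_0`. [ours] -/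
theorem imageCount_mixing_floor (L : Fin (K + 1) → Equiv.Perm S) (B : Finset S) (hμ : ∀ k x, 0 < μ k x)
    (hμ1 : ∀ k, ∑ u, μ k u = 1) {u₀ : S} (hu₀ : u₀ ∉ B)
    (hm : 16 ≤ ∑ k : Fin (K + 1), ∑ u ∈ B.map (L k).symm.toEmbedding, μ k u)
    {P Q : Matrix (Fin (K + 1) → S) (Fin (K + 1) → S) ℝ} (hP : IsRowStochastic P) (hQ : IsRowStochastic Q)
    {s : ℝ} (hs0 : 0 ≤ s) (hs1 : s ≤ 1) (hPdef : ∀ x y, P x y = s * Q x y + (1 - s) * prodKernel w M x y)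
    (hQA : ∀ x y, Q x y ≠ 0 → ∑ k, (if y k ∈ B.map (L k).symm.toEmbedding then (1 : ℝ) else 0)
      = ∑ k, (if x k ∈ B.map (L k).symm.toEmbedding then (1 : ℝ) else 0))
    (hM : ∀ k, IsRowStochastic (M k)) (hw0 : ∀ k, 0 ≤ w k) (hw1 : ∑ k, w k = 1)
    (hfrozen : ∀ k : Fin (K + 1), k ≠ 0 → ∀ u v, M k u v ≠ 0 →
      (u ∈ B.map (L k).symm.toEmbedding ↔ v ∈ B.map (L k).symm.toEmbedding))
    {t : ℕ} (ht : worstTvDist P (tensorFun μ) t ≤ 1 / 4) :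
    ∑ k : Fin (K + 1), ∑ u ∈ B.map (L k).symm.toEmbedding, μ k u < 8 * t * ((1 - s) * w 0) := by
  -- membership in the images
  have hmem : ∀ (k : Fin (K + 1)) (u : S), (L k).symm u ∈ B.map (L k).symm.toEmbedding ↔ u ∈ B := fun k u => by
    rw [Finset.mem_map_equiv, Equiv.symm_symm, Equiv.apply_symm_apply]
  -- the relabelling `Ψ(x)_k = L_k x_k` and the conjugated objects
  set Ψ : (Fin (K + 1) → S) ≃ (Fin (K + 1) → S) := Equiv.piCongrRight L with hΨ
  have hΨs : ∀ (a : Fin (K + 1) → S) (k : Fin (K + 1)), Ψ.symm a k = (L k).symm (a k) := fun a k => rfl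
  set ν : Fin (K + 1) → S → ℝ := fun i u => μ i ((L i).symm u) with hν
  set M' : Fin (K + 1) → S → S → ℝ := fun i u v => M i ((L i).symm u) ((L i).symm v) with hM'
  set P' : Matrix (Fin (K + 1) → S) (Fin (K + 1) → S) ℝ := fun a b => P (Ψ.symm a) (Ψ.symm b) with hP'
  set Q' : Matrix (Fin (K + 1) → S) (Fin (K + 1) → S) ℝ := fun a b => Q (Ψ.symm a) (Ψ.symm b) with hQ'
  have hν0 : ∀ k u, 0 < ν k u := fun k u => hμ k _
  have hν1 : ∀ k, ∑ u, ν k u = 1 := fun k => by rw [hν]; simp only; rw [Equiv.sum_comp (L k).symm (μ k)]; exact hμ1 k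
  have hm' : 16 ≤ ∑ k : Fin (K + 1), ∑ u ∈ B, ν k u := by
    simp only [hν, sum_relabel_set]; exact hm
  have hP'st : IsRowStochastic P' :=
    ⟨fun a b => hP.1 _ _, fun a => by simpa using (Equiv.sum_comp Ψ.symm (fun y => P (Ψ.symm a) y)).trans (hP.2 _)⟩
  have hQ'st : IsRowStochastic Q' :=
    ⟨fun a b => hQ.1 _ _, fun a => by simpa using (Equiv.sum_comp Ψ.symm (fun y => Q (Ψ.symm a) y)).trans (hQ.2 _)⟩
  have hM'st : ∀ k, IsRowStochastic (M' k) := fun k =>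
    ⟨fun u v => (hM k).1 _ _, fun u => by simpa using (Equiv.sum_comp (L k).symm (fun v => M k ((L k).symm u) v)).trans ((hM k).2 _)⟩
  have hPdef' : ∀ a b, P' a b = s * Q' a b + (1 - s) * prodKernel w M' a b := by
    intro a b
    have ha : (fun i => L i (Ψ.symm a i)) = a := funext fun i => by rw [hΨs, Equiv.apply_symm_apply]
    have hb : (fun i => L i (Ψ.symm b i)) = b := funext fun i => by rw [hΨs, Equiv.apply_symm_apply]
    simp only [hP', hQ']
    rw [hPdef, prodKernel_conj L w M (Ψ.symm a) (Ψ.symm b), ha, hb]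
  have hcount : ∀ a : Fin (K + 1) → S, ∑ k, (if Ψ.symm a k ∈ B.map (L k).symm.toEmbedding then (1 : ℝ) else 0)
      = ∑ k, (if a k ∈ B then (1 : ℝ) else 0) := fun a => sum_congr rfl fun k _ => by simp only [hΨs, hmem]
  have hQA' : ∀ a b, Q' a b ≠ 0 → ∑ k, (if b k ∈ B then (1 : ℝ) else 0) = ∑ k, (if a k ∈ B then (1 : ℝ) else 0) := by
    intro a b hab
    rw [← hcount a, ← hcount b]
    exact hQA _ _ hab
  have hfrozen' : ∀ k : Fin (K + 1), k ≠ 0 → ∀ u v, M' k u v ≠ 0 → (u ∈ B ↔ v ∈ B) := by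
    intro k hk u v huv
    rw [← hmem k u, ← hmem k v]
    exact hfrozen k hk _ _ huv
  -- the distance to stationarity is the same in both coordinates
  have hπ : (fun a => tensorFun ν (Ψ a)) = tensorFun μ := by
    funext a; rw [hν]; exact (tensorFun_relabel L μ a).symm
  have hPP : (fun a b => P' (Ψ a) (Ψ b)) = P := by
    funext a b; simp only [hP', Equiv.symm_apply_apply]
  have ht' : worstTvDist P' (tensorFun ν) t ≤ 1 / 4 := by
    rw [← worstTvDist_relabel Ψ P' (tensorFun ν) t, hPP, hπ]; exact ht
  have h := weightedScheme_mixing_floor (μ := ν) (M := M') (w := w) (A := B) hν0 hν1 hu₀ hm' hP'st hQ'st hs0 hs1 hPdef'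
    hQA' hM'st hw0 hw1 hfrozen' ht'
  simp only [hν, sum_relabel_set] at h
  exact h

/-- **THE SAME FOR A `φ`-EQUIVARIANT FAMILY:** bijections `φ_j`, sets `A_{j+1} = φ_j(A_j)` with `A_0` missing a point and
`Σ_kμ_k(A_k) ≥ 16`; `Q` ANY row-stochastic matrix preserving `Σ_k1[x_k ∈ A_k]` (every schedule of map swaps through the
`φ_j` does, whatever its acceptance rule); cold `M_k` frozen pointwise on `A_k`; `P = sQ + (1−s)·prodKernel w M`:
`d(t) ≤ 1/4 ⇒ Σ_kμ_k(A_k) < 8·t·(1−s)·w_0` — more than `Σ_kμ_k(A_k)/(8(1−s)w_0)` steps, order `K` at best. [ours] -/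
theorem equivariantCount_mixing_floor (φ : Fin K → Equiv.Perm S) (A : Fin (K + 1) → Finset S)
    (hAφ : ∀ j : Fin K, A j.succ = (A j.castSucc).map (φ j).toEmbedding) (hμ : ∀ k x, 0 < μ k x)
    (hμ1 : ∀ k, ∑ u, μ k u = 1) {u₀ : S} (hu₀ : u₀ ∉ A 0) (hm : 16 ≤ ∑ k : Fin (K + 1), ∑ u ∈ A k, μ k u)
    {P Q : Matrix (Fin (K + 1) → S) (Fin (K + 1) → S) ℝ} (hP : IsRowStochastic P) (hQ : IsRowStochastic Q)
    {s : ℝ} (hs0 : 0 ≤ s) (hs1 : s ≤ 1) (hPdef : ∀ x y, P x y = s * Q x y + (1 - s) * prodKernel w M x y)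
    (hQA : ∀ x y, Q x y ≠ 0 → ∑ k, (if y k ∈ A k then (1 : ℝ) else 0) = ∑ k, (if x k ∈ A k then (1 : ℝ) else 0))
    (hM : ∀ k, IsRowStochastic (M k)) (hw0 : ∀ k, 0 ≤ w k) (hw1 : ∑ k, w k = 1)
    (hfrozen : ∀ k : Fin (K + 1), k ≠ 0 → ∀ u v, M k u v ≠ 0 → (u ∈ A k ↔ v ∈ A k))
    {t : ℕ} (ht : worstTvDist P (tensorFun μ) t ≤ 1 / 4) :
    ∑ k : Fin (K + 1), ∑ u ∈ A k, μ k u < 8 * t * ((1 - s) * w 0) := by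
  obtain ⟨L, hL0, hLφ⟩ := exists_levelMaps φ
  have hAk : ∀ k : Fin (K + 1), A k = (A 0).map (L k).symm.toEmbedding := by
    intro k
    induction k using Fin.induction with
    | zero =>
      rw [hL0]
      ext u
      simp
    | succ j ih => rw [hAφ j, ih, imageFamily_succ L φ hLφ (A 0) j]
  have h := imageCount_mixing_floor (μ := μ) (M := M) (w := w) L (A 0) hμ hμ1 hu₀ (by simp only [← hAk]; exact hm) hP hQ
    hs0 hs1 hPdef (fun x y hxy => by simp only [← hAk]; exact hQA x y hxy) hM hw0 hw1
    (fun k hk u v huv => by simp only [← hAk]; exact hfrozen k hk u v huv) ht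
  simp only [← hAk] at h
  exact h

end Summit.Ventures.LatticeQCDFlow.Scaling

end
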